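import Literature.Geometry.Kaehler.ComplexProjectiveSpaceFubiniStudy
import Literature.Geometry.Symplectic.SphereProdSymplecticHost
import Literature.Topology.FourManifolds.ComplexProjectiveSpaceProofs

/-!
# Line `stable-seam-host` (crux `OrigamiFoldExistence`, stmt-SmoothPoincare4-7844), registry v2: the second host disjunct is non-vacuous — `(ℂℙ², ω_FS)` is a rational host

Helper certificate of lead c10, wave 1 (the `ℂℙ²` analogue of the landed
`helper_hostPackage_sphereProd` / `helper_hostPackage_of_diffeomorph_sphereProd`).  Registry v2
of the line widened the host notion of the stubs `stub_hostEmbedding` /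
`stub_stableRepresentative` / `stub_stableSeamRigidity` from "closed simply connected symplectic
`(X, Ω)` with a square-zero symplectic sphere pair" to "… ∨ `(X, Ω) ≅ (ℂℙ², a • ω_FS)` for some
`a > 0`", so that the tree's Gluck-twist dissolution `Σ_K # ℂℙ² ≅ ℂℙ²` feeds
`stub_hostEmbedding`.  This file certifies that the new disjunct is inhabited, as typed, by the
tree's own Fubini–Study plane, and transports it along diffeomorphisms:

* `helper_hostPackage_complexProjectivePlane` (registered helper) — the Fubini–Study form
  `CPn.fsForm 2` on `Literature.Topology.FourManifolds.ComplexProjectivePlane` (the tree's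
  `ℂℙ²` charted on the literal model `EuclideanSpace ℝ (Fin 4)`) is smooth, closed and
  non-degenerate (tree theorems `CPn.isSmoothForm_fsForm`, `CPn.isClosedForm_fsForm`,
  `CPn.fsForm_nondegenerate` of `Literature/Geometry/Kaehler/ComplexProjectiveSpaceFubiniStudy.lean`;
  Huybrechts 2005, §3.1 Examples 3.1.9 i); McDuff–Salamon 2017, Example 4.3.3), and
  `ω_FS = 1 • id^* ω_FS` through the identity diffeomorphism (`Diffeomorph.refl`, `mfderiv_id`).
* `helper_hostPackage_of_diffeomorph_complexProjectivePlane` (rider) — the HOST HALF of the glue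
  "Gluck twist ⇒ `stub_hostEmbedding`" with the form made explicit: every `ℝ⁴`-charted `C^∞`
  manifold `P` with a diffeomorphism `Φ : P ≃ₘ ℂℙ²` carries the symplectic form `Φ^* ω_FS`
  (tree theorem `Literature.Geometry.Symplectic.isSymplectic_pullback_diffeomorph`;
  McDuff–Salamon 2017, §3.1) and is a rational host through `Ψ := Φ`, `a := 1`
  (`MForm.pullback_apply`).
* `helper_hostPackageV2_of_diffeomorph_complexProjectivePlane` (rider, the shape of
  `helper_hostPackage_of_diffeomorph_sphereProd`) — such a `P` is moreover Hausdorff, second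
  countable, compact and simply connected (transport along the homeomorphism `Φ`; `ℂℙ²` is simply
  connected by the tree theorem `simplyConnectedSpace_complexProjectivePlane_holds`,
  Milnor–Stasheff §14), and carries SOME form `Ω` with the symplectic and (v2) host clauses —
  exactly the `X := P` instance of the conclusion of the lead's
  `helper_hostEmbedding_of_connectedSum_complexProjectivePlane` minus its embedding clause.

No definitions, no named facts, no `sorry`.
-/

noncomputable section

-- the prescribed namespace `Summit.<P>.<Sub>.…` duplicates `SmoothPoincare4` (P = Sub)
set_option linter.dupNamespace false

open scoped Manifold ContDiff Topology
open Set Function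

namespace Summit.SmoothPoincare4.SmoothPoincare4.Theorems.OrigamiFoldExistence.StableSeamHost

open Literature.Geometry.Kaehler Literature.Geometry.Symplectic Literature.Topology.FourManifolds

/-- **`(ℂℙ², ω_FS)` is a rational host (registry v2, second disjunct)**: the Fubini–Study form
`CPn.fsForm 2` on the tree's `ℝ⁴`-charted `ComplexProjectivePlane` is smooth, closed and
non-degenerate (`CPn.isSmoothForm_fsForm`, `CPn.isClosedForm_fsForm`, `CPn.fsForm_nondegenerate`;
Huybrechts 2005, §3.1 Examples 3.1.9 i)), and `ω_FS = 1 • id^* ω_FS` through the identity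
diffeomorphism `Diffeomorph.refl` (`mfderiv_id`). [folklore] -/
theorem helper_hostPackage_complexProjectivePlane :
    (Literature.Geometry.Kaehler.IsSmoothForm (Literature.Geometry.Kaehler.CPn.fsForm 2) ∧ Literature.Geometry.Kaehler.IsClosedForm (Literature.Geometry.Kaehler.CPn.fsForm 2) ∧ ∀ x (v : TangentSpace (𝓡 4) x), v ≠ 0 → ∃ w, (Literature.Geometry.Kaehler.CPn.fsForm 2 : Literature.Geometry.Kaehler.MForm (𝓡 4) Literature.Topology.FourManifolds.ComplexProjectivePlane ℝ 2) x ![v, w] ≠ 0) ∧ ((∃ c c' : (Metric.sphere (0 : EuclideanSpace ℝ (Fin 3)) 1) → Literature.Topology.FourManifolds.ComplexProjectivePlane, (Manifold.IsSmoothEmbedding (𝓡 2) (𝓡 4) ∞ c ∧ (∀ y (v : TangentSpace (𝓡 2) y), v ≠ 0 → ∃ w : TangentSpace (𝓡 2) y, (Literature.Geometry.Kaehler.CPn.fsForm 2 : Literature.Geometry.Kaehler.MForm (𝓡 4) Literature.Topology.FourManifolds.ComplexProjectivePlane ℝ 2) (c y) ![mfderiv (𝓡 2) (𝓡 4) c y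 v, mfderiv (𝓡 2) (𝓡 4) c y w] ≠ 0) ∧ Manifold.IsSmoothEmbedding (𝓡 2) (𝓡 4) ∞ c' ∧ Disjoint (Set.range c) (Set.range c') ∧ ∃ H : unitInterval × (Metric.sphere (0 : EuclideanSpace ℝ (Fin 3)) 1) → Literature.Topology.FourManifolds.ComplexProjectivePlane, Continuous H ∧ ∀ y, H (0, y) = c y ∧ H (1, y) = c' y)) ∨ (∃ (Ψ : Literature.Topology.FourManifolds.ComplexProjectivePlane ≃ₘ⟮𝓡 4, 𝓡 4⟯ Literature.Topology.FourManifolds.ComplexProjectivePlane) (a : ℝ), 0 < a ∧ ∀ x (v w : TangentSpace (𝓡 4) x), (Literature.Geometry.Kaehler.CPn.fsForm 2 : Literature.Geometry.Kaehler.MForm (𝓡 4) Literature.Topology.FourManifolds.ComplexProjectivePlane ℝ 2) x ![v, w] = a * Literature.Geometry.Kaehler.CPn.fsForm 2 (Ψ x) ![mfderiv (𝓡 4) (𝓡 4) Ψ x v, mfderiv (𝓡 4) (𝓡 4) Ψ x w])) := by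
  refine ⟨⟨CPn.isSmoothForm_fsForm, CPn.isClosedForm_fsForm, CPn.fsForm_nondegenerate⟩,
    Or.inr ⟨Diffeomorph.refl (𝓡 4) ComplexProjectivePlane ∞, 1, one_pos, fun x v w ↦ ?_⟩⟩
  rw [Diffeomorph.coe_refl, mfderiv_id, one_mul]
  rfl

/-- **Transport of the `ℂℙ²` host package along a diffeomorphism, explicit form**: for an
`ℝ⁴`-charted `C^∞` manifold `P` and a diffeomorphism `Φ : P ≃ₘ ℂℙ²`, the pulled-back
Fubini–Study form `Φ^* ω_FS` is smooth, closed and non-degenerate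
(`isSymplectic_pullback_diffeomorph`; McDuff–Salamon 2017, §3.1), and `(P, Φ^* ω_FS)` is a
rational host through `Ψ := Φ`, `a := 1`: `(Φ^* ω_FS)_x (v, w) = ω_FS (dΦ v, dΦ w)`
(`MForm.pullback_apply`). [folklore] -/
theorem helper_hostPackage_of_diffeomorph_complexProjectivePlane :
    ∀ (P : Type) [TopologicalSpace P] [ChartedSpace (EuclideanSpace ℝ (Fin 4)) P] [IsManifold (𝓡 4) ∞ P] (Φ : P ≃ₘ⟮𝓡 4, 𝓡 4⟯ Literature.Topology.FourManifolds.ComplexProjectivePlane), (Literature.Geometry.Kaehler.IsSmoothForm ((Literature.Geometry.Kaehler.CPn.fsForm 2 : Literature.Geometry.Kaehler.MForm (𝓡 4) Literature.Topology.FourManifolds.ComplexProjectivePlane ℝ 2).pullback (𝓡 4) Φ) ∧ Literature.Geometry.Kaehler.IsClosedForm ((Literature.Geometry.Kaehler.CPn.fsForm 2 : Literature.Geometry.Kaehler.MForm (𝓡 4) Literature.Topology.FourManifolds.ComplexProjectivePlane ℝ 2).pullback (𝓡 4) Φ) ∧ ∀ x (v : TangentSpace (𝓡 4) x), v ≠ 0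 → ∃ w, ((Literature.Geometry.Kaehler.CPn.fsForm 2 : Literature.Geometry.Kaehler.MForm (𝓡 4) Literature.Topology.FourManifolds.ComplexProjectivePlane ℝ 2).pullback (𝓡 4) Φ) x ![v, w] ≠ 0) ∧ ((∃ c c' : (Metric.sphere (0 : EuclideanSpace ℝ (Fin 3)) 1) → P, (Manifold.IsSmoothEmbedding (𝓡 2) (𝓡 4) ∞ c ∧ (∀ y (v : TangentSpace (𝓡 2) y), v ≠ 0 → ∃ w : TangentSpace (𝓡 2) y, ((Literature.Geometry.Kaehler.CPn.fsForm 2 : Literature.Geometry.Kaehler.MForm (𝓡 4) Literature.Topology.FourManifolds.ComplexProjectivePlane ℝ 2).pullback (𝓡 4) Φ) (c y) ![mfderiv (𝓡 2) (𝓡 4) c y v, mfderiv (𝓡 2) (𝓡 4) c y w] ≠ 0) ∧ Manifold.IsSmoothEmbedding (𝓡 2) (𝓡 4) ∞ c' ∧ Disjoint (Set.range c) (Set.range c') ∧ ∃ H : unitInterval × (Metric.sphere (0 : EuclideanSpace ℝ (Fin 3)) 1) → P, Continuous H ∧ ∀ y, H (0, y) = c y ∧ H (1, y) = c' y)) ∨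 (∃ (Ψ : P ≃ₘ⟮𝓡 4, 𝓡 4⟯ Literature.Topology.FourManifolds.ComplexProjectivePlane) (a : ℝ), 0 < a ∧ ∀ x (v w : TangentSpace (𝓡 4) x), ((Literature.Geometry.Kaehler.CPn.fsForm 2 : Literature.Geometry.Kaehler.MForm (𝓡 4) Literature.Topology.FourManifolds.ComplexProjectivePlane ℝ 2).pullback (𝓡 4) Φ) x ![v, w] = a * Literature.Geometry.Kaehler.CPn.fsForm 2 (Ψ x) ![mfderiv (𝓡 4) (𝓡 4) Ψ x v, mfderiv (𝓡 4) (𝓡 4) Ψ x w])) := by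
  intro P _ _ _ Φ
  refine ⟨isSymplectic_pullback_diffeomorph Φ
      ⟨CPn.isSmoothForm_fsForm, CPn.isClosedForm_fsForm, CPn.fsForm_nondegenerate⟩,
    Or.inr ⟨Φ, 1, one_pos, fun x v w ↦ ?_⟩⟩
  rw [MForm.pullback_apply, one_mul]
  congr 1
  funext i
  fin_cases i <;> rfl

/-- **Transport of the `ℂℙ²` host package along a diffeomorphism, point-set instances included**
(the shape of `helper_hostPackage_of_diffeomorph_sphereProd`): an `ℝ⁴`-charted `C^∞` manifold `P`
diffeomorphic to `ℂℙ²` is Hausdorff, second countable, compact (transport along the homeomorphism)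
and simply connected (`ContinuousMap.HomotopyEquiv.simplyConnectedSpace` and the tree theorem
`simplyConnectedSpace_complexProjectivePlane_holds`, Milnor–Stasheff §14), and carries a smooth
closed non-degenerate 2-form satisfying the v2 host clause, namely `Φ^* ω_FS`
(`helper_hostPackage_of_diffeomorph_complexProjectivePlane`). [folklore] -/
theorem helper_hostPackageV2_of_diffeomorph_complexProjectivePlane :
    ∀ (P : Type) [TopologicalSpace P] [ChartedSpace (EuclideanSpace ℝ (Fin 4)) P] [IsManifold (𝓡 4) ∞ P], Nonempty (P ≃ₘ⟮𝓡 4, 𝓡 4⟯ Literature.Topology.FourManifolds.ComplexProjectivePlane) → ∃ (_ : T2Space P) (_ : SecondCountableTopology P) (_ : CompactSpace P) (_ : SimplyConnectedSpace P) (Ω : Literature.Geometry.Kaehler.MForm (𝓡 4) P ℝ 2), (Literature.Geometry.Kaehler.IsSmoothForm Ω ∧ Literature.Geometry.Kaehler.IsClosedForm Ω ∧ ∀ x (v : TangentSpace (𝓡 4) x), v ≠ 0 → ∃ w, Ω x ![v, w] ≠ 0) ∧ ((∃ c c' : (Metric.sphere (0 : EuclideanSpace ℝ (Fin 3)) 1)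 → P, (Manifold.IsSmoothEmbedding (𝓡 2) (𝓡 4) ∞ c ∧ (∀ y (v : TangentSpace (𝓡 2) y), v ≠ 0 → ∃ w : TangentSpace (𝓡 2) y, Ω (c y) ![mfderiv (𝓡 2) (𝓡 4) c y v, mfderiv (𝓡 2) (𝓡 4) c y w] ≠ 0) ∧ Manifold.IsSmoothEmbedding (𝓡 2) (𝓡 4) ∞ c' ∧ Disjoint (Set.range c) (Set.range c') ∧ ∃ H : unitInterval × (Metric.sphere (0 : EuclideanSpace ℝ (Fin 3)) 1) → P, Continuous H ∧ ∀ y, H (0, y) = c y ∧ H (1, y) = c' y)) ∨ (∃ (Ψ : P ≃ₘ⟮𝓡 4, 𝓡 4⟯ Literature.Topology.FourManifolds.ComplexProjectivePlane) (a : ℝ), 0 < a ∧ ∀ x (v w : TangentSpace (𝓡 4) x), Ω x ![v, w] = a * Literature.Geometry.Kaehler.CPn.fsForm 2 (Ψ x) ![mfderiv (𝓡 4) (𝓡 4) Ψ x v, mfderiv (𝓡 4) (𝓡 4) Ψ x w])) := by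
  intro P _ _ _ hΦ
  obtain ⟨Φ⟩ := hΦ
  let e : P ≃ₜ ComplexProjectivePlane := Φ.toHomeomorph
  haveI : T2Space P := e.symm.t2Space
  haveI : SecondCountableTopology P := e.secondCountableTopology
  haveI : CompactSpace P := e.symm.compactSpace
  haveI : SimplyConnectedSpace ComplexProjectivePlane :=
    simplyConnectedSpace_complexProjectivePlane_holds
  haveI : SimplyConnectedSpace P := e.toHomotopyEquiv.simplyConnectedSpace
  exact ⟨inferInstance, inferInstance, inferInstance, inferInstance, _,
    helper_hostPackage_of_diffeomorph_complexProjectivePlane P Φ⟩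

end Summit.SmoothPoincare4.SmoothPoincare4.Theorems.OrigamiFoldExistence.StableSeamHost

end
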